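import Summits.QuantumFields.YangMills.Theorems.UnitScaleTiltFluctuationComparisonRegPrIntLOnChi
import HarnessLib

/-!
# `UnitScaleTiltFluctuationComparisonRegPrIntLOnChiPrint` — the record-free §2 engine WITH BOTH ROWS ON PRINT'S χ: «(41)∧(47) AND King's Cauchy property read on print's χ of
# the datum's own minimiser + [Balaban1985Variational] Thm 1 (8) in ∀-form ⟹ the interior comparison» — no `ChiGood`, no margin `μ`, no Thm-1 ∃-form
# (crux `FluctuationComparisonRegPrIntL`, stmt-QuantumFields-20520; width-lever lane `ym-ust-19935-r1` g3, «(R1) print's χ of [Balaban1985UV3] (47) back»)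

Count-neutral helper (`--supports stmt-QuantumFields-20520`); registry untouched; no numerics; nothing of [Balaban1985UV3]/[King1986]/[Balaban1985Variational] asserted.

WHY.  `…IntLOnChi.regPrIntL_of_dataOnPrintChi` (p550585) reads conjunct (A) on print's χ `atHeights (printChiSets D b₀ p₀)` but King's Cauchy property on the doubly-`ChiGood(μ_L)`-good
data — the currency of the registered inner stub (i*) (`GlobalSupRateTSlackOn (ChiGood … μ)` for every margin `μ`), whose one-token successor (i*)χ the v5kC pen registers (OWNER RULING
g23-№2 ADD. 6).  Once the re-typed record DISPLAYS print's χ (★alpha-1's `PinnedStep.loPrintAC` = ★r1's `printChiSets` at the T³ objects), the slack row can equally be read ON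
PRINT'S χ — the set on which the minimiser's (44)-regularity, i.e. the configuration-dependent chart rows of the K1a interface, live by definition.  This file is the engine for that
option: with BOTH rows on `atHeights (printChiSets D b₀ p₀)` the c-interior discharge is §3 of `…IntLOnChi` twice, so [Balaban1985Variational] Thm 1 enters ONLY through its (8)-clause
in ∀-form `MinimisersIn8At` (T8's second conjunct) — no `ChiGood`, no transfer lemma, no margin.  Offered to the owner as the alternative currency (i*)χ′ :=
`GlobalSupRateTSlackOn (atHeights (printChiSets (dataOfV3chi p π) b₀ p₀)) (dataOfV3chi p π) b₀ p₀ a σ C`; the χ-S-E″ `PrintChi.levelCauchyOnOfGlobalSupRateTSlackOn_dec` is generic in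
the predicate and turns it into hypothesis (c′) below.

References: T. Bałaban, CMP 102 (1985) 255–275 [Balaban1985UV3] ((41) p.266, (44) p.267, (47) p.267); CMP 102 (1985) 277–309 [Balaban1985Variational] (Thm 1 (8) p.279, Prop 8
p.304); C. King, CMP 102 (1986) 649–677 [King1986] (Thm 3.4 (3.9) p.656, Props 3.8–3.9 pp.664–665).
-/

set_option autoImplicit false

noncomputable section

namespace Summit.QuantumFields.YangMills.Theorems.InteriorExcision

open MeasureTheory Filter
open Literature.MathematicalPhysics.QuantumFieldTheory.Balaban1983to89
open Literature.MathematicalPhysics.QuantumFieldTheory.Balaban1983to89.T3ContinuumYM3Torus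
open Literature.MathematicalPhysics.QuantumFieldTheory.Balaban1983to89.T3LevelShift
open Literature.MathematicalPhysics.QuantumFieldTheory.Balaban1983to89.T3UnitLawDensityEML (ℰp measurableE_ℰp)
open Literature.MathematicalPhysics.QuantumFieldTheory.Balaban1983to89.T3UnitScaleTilt
open Literature.MathematicalPhysics.QuantumFieldTheory.Balaban1983to89.T3RestrictedUnitDensity
open Literature.MathematicalPhysics.QuantumFieldTheory.Balaban1983to89.T3TiltDescent
open Literature.MathematicalPhysics.QuantumFieldTheory.Balaban1983to89.T3CruxEstimates
open Literature.MathematicalPhysics.QuantumFieldTheory.Balaban1983to89.T3RegularMinimiser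
open Literature.MathematicalPhysics.QuantumFieldTheory.Balaban1983to89.T3PrintedRegularMinimiser
open Literature.MathematicalPhysics.QuantumFieldTheory.Balaban1983to89.T3PrintedMinimiserExistence
open Literature.MathematicalPhysics.QuantumFieldTheory.Balaban1983to89.T3MinimiserStabilityReduction (θBal_pos)
open Literature.MathematicalPhysics.QuantumFieldTheory.Balaban1983to89.T3ThresholdSmallness (exists_forall_θBal_le)
open Literature.MathematicalPhysics.QuantumFieldTheory.Balaban1983to89.T3InteriorExcision
open Literature.MathematicalPhysics.QuantumFieldTheory.Balaban1983to89.T3LogComparisonSocket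
open Literature.MathematicalPhysics.QuantumFieldTheory.Balaban1983to89.T3AlphaInputsAC
open Literature.MathematicalPhysics.QuantumFieldTheory.Balaban1983to89.T3LowerAlongMinimisersSplit (MinimisersIn8At)
open Literature.MathematicalPhysics.QuantumFieldTheory.Balaban1983to89.Missing
open Summit.QuantumFields.YangMills.Theorems.PrintChi
open Summit.QuantumFields.YangMills.Theorems.LogComparisonRepAtHeightsOn (atHeights printChiSets)

/-- **`FluctuationComparisonRegPrIntL` ⇐ WINDOW POSITIVITY + [Balaban1985Variational] THM 1 (8) IN ∀-FORM + A DATUM WITH (41)∧(47) AND KING'S CAUCHY PROPERTY BOTH ON PRINT'S χ.**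
Hypotheses in the route's prefix: `hIn8` = for every odd `L > 1`, constants `a₀ a₁ B₃ > 0` with `MinimisersIn8At L a₀ a₁ B₃` (every minimiser over print's space (6)(ε₀) of an
`ε₁`-small datum lies in (8)(B₃ε₁) — T8's second conjunct); `hData` = per block size thresholds `(b₁, p₁)`, then `ε₁`, `m₀`, `γ₁`, and per family a datum `D : AlphaDataT3 F γ` with
(a) the `UminTrivIsRegMinimiser` clauses at heights `n < K`, (b) (41)∧(47) pinned ON print's χ `atHeights (printChiSets D b₀ p₀)`, (c′) King's cut-off-Cauchy property of `D.PintH`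
along the free fraction `m` ON THE SAME print-χ-good data; `hPos` = positivity of both restricted densities on the window (STUB 1 shape).  Conclusion: `FluctuationComparisonRegPrIntL`,
`c := (max B₃ 1)⁻¹`, `m₀ ≥ 2`, ONE chain for every odd `L` — per family `fluctuationComparisonRegPrIntAt_of_repOn_cauchyOn_interior` at `S₁ = S₂ :=` print's χ of `D.Umin`, both
discharged on the interior by `atHeights_printChiSets_of_interior`.  No `ChiGood`, no margin, no Thm-1 ∃-form. [cite: Balaban1985UV3, (41) p.266 and (47) p.267;
Balaban1985Variational, Thm 1 (8) p.279; King1986, Prop. 3.8-3.9 pp.664-665] -/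
theorem regPrIntL_of_dataOnPrintChiBoth
    (hIn8 : ∀ L : ℕ, Odd L → 1 < L → ∃ a₀ a₁ B₃ : ℝ, 0 < a₀ ∧ 0 < a₁ ∧ 0 < B₃ ∧ MinimisersIn8At L a₀ a₁ B₃)
    (hData : ∀ L : ℕ, Odd L → 1 < L → ∃ (b₁ p₁ : ℝ), ∀ (b₀ p₀ : ℝ), b₁ ≤ b₀ → p₁ ≤ p₀ → 0 < b₀ → 2 < p₀ →
      ∃ ε₁ : ℝ, 0 < ε₁ ∧ ∀ (ε₀ : ℝ), 0 < ε₀ → ε₀ ≤ ε₁ → ∃ m₀ : ℕ, ∀ (m : ℕ), m₀ ≤ m →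
        ∃ γ₁ : ℝ, 0 < γ₁ ∧ ∀ (F : T3Family) (γ : ℝ), F.L = L → 0 < γ → γ ≤ γ₁ →
          ∃ D : AlphaDataT3 F γ,
            (∀ (K n : ℕ) (hnK : n < K) (V : GaugeField (F.P n) 0 (Matrix.specialUnitaryGroup (Fin 2) ℂ)),
              PlaqSmall (θBal F.L γ b₀ p₀ n) V →
                D.Umin K (K - n) (D.triv K (K - n))
                    (fieldShift (F.sitesPerDir_eq (m := F.m) (K := K) (j := K - n) (m' := F.m) (K' := n) (j' := 0) (by omega)) V) ∈
                  regFibrePr F n K hnK.le ε₀ V ∧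
                wilsonAction4 (D.Umin K (K - n) (D.triv K (K - n))
                    (fieldShift (F.sitesPerDir_eq (m := F.m) (K := K) (j := K - n) (m' := F.m) (K' := n) (j' := 0) (by omega)) V)) =
                  minActionRegPr F n K hnK.le ε₀ V) ∧
            TwoSidedRepOn F γ b₀ p₀ (atHeights (printChiSets D b₀ p₀)) ε₀ D.PintH D.EcstH D.RmH ∧
            PintCauchyOn F γ b₀ p₀ (atHeights (printChiSets D b₀ p₀)) m D.PintH)
    (hPos : ∀ (L m : ℕ), 0 < m → ∀ (b₀ p₀ : ℝ), 0 < b₀ → 2 < p₀ → ∃ γ₁ : ℝ, 0 < γ₁ ∧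
      ∀ (F : T3Family) (γ : ℝ), F.L = L → 0 < γ → γ ≤ γ₁ →
        ∀ K, ∀ᵐ V ∂fieldMeasure (F.P (K / m)) 0 (Matrix.specialUnitaryGroup (Fin 2) ℂ),
          PlaqSmall (θBal F.L γ b₀ p₀ (K / m)) V →
            0 < heightDensity F γ (Nat.div_le_self K m) (histGood F ℰp (θBal F.L γ b₀ p₀) K (K / m)) V ∧
            0 < heightDensity F γ ((Nat.div_le_self K m).trans (Nat.le_succ K))
                  (histGood F ℰp (θBal F.L γ b₀ p₀) (K + 1) (K / m)) V) :
    FluctuationComparisonRegPrIntL := by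
  intro L
  by_cases hL : Odd L ∧ 1 < L
  swap
  · -- no family has this block size
    refine ⟨1, 0, 0, one_pos, le_rfl, fun b₀ p₀ _ _ _ _ => ⟨1, one_pos, fun ε₀ _ _ => ⟨0, fun m _ => ⟨1, one_pos, ?_⟩⟩⟩⟩
    intro F γ hF
    exact absurd (hF ▸ F.hL : Odd L ∧ 1 < L) hL
  obtain ⟨a₀, a₁, B₃, ha₀, ha₁, hB₃, hI8⟩ := hIn8 L hL.1 hL.2
  obtain ⟨b₁, p₁, hD⟩ := hData L hL.1 hL.2
  have hM : 0 < max B₃ 1 := lt_max_of_lt_right one_pos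
  have hc0 : 0 < (max B₃ 1)⁻¹ := inv_pos.mpr hM
  have hc1 : (max B₃ 1)⁻¹ ≤ 1 := inv_le_one_of_one_le₀ (le_max_right _ _)
  have hcB : B₃ * (max B₃ 1)⁻¹ ≤ 1 := by
    rw [← div_eq_mul_inv, div_le_one hM]
    exact le_max_left _ _
  refine ⟨(max B₃ 1)⁻¹, b₁, p₁, hc0, hc1, fun b₀ p₀ hb₁ hp₁ hb hp => ?_⟩
  obtain ⟨ε₁, hε₁, hD1⟩ := hD b₀ p₀ hb₁ hp₁ hb hp
  refine ⟨min ε₁ a₀, lt_min hε₁ ha₀, fun ε₀ hε₀ hε₀le => ?_⟩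
  have hε₀1 : ε₀ ≤ ε₁ := hε₀le.trans (min_le_left _ _)
  have hε₀a : ε₀ ≤ a₀ := hε₀le.trans (min_le_right _ _)
  obtain ⟨m₀, hD2⟩ := hD1 ε₀ hε₀ hε₀1
  refine ⟨max m₀ 2, fun m hm => ?_⟩
  have hm2 : 2 ≤ m := (le_max_right _ _).trans hm
  obtain ⟨γ₁, hγ₁, hD3⟩ := hD2 m ((le_max_left _ _).trans hm)
  -- thresholds of the (8)-discharge: `θBal(c·b₀) ≤ a₁`, `B₃θBal(c·b₀) ≤ ε₀`; and `γ ≤ 1`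
  obtain ⟨γI, hγI, hI⟩ := exists_forall_θBal_le hL.2.le ((max B₃ 1)⁻¹ * b₀) p₀ (lt_min ha₁ (div_pos hε₀ hB₃))
  obtain ⟨γP, hγP, hP⟩ := hPos L m (by omega) b₀ p₀ hb hp
  refine ⟨min (min γ₁ 1) (min γI γP), lt_min (lt_min hγ₁ one_pos) (lt_min hγI hγP), fun F γ hF hγ hγle => ?_⟩
  have hγ₁' : γ ≤ γ₁ := hγle.trans ((min_le_left _ _).trans (min_le_left _ _))
  have hγ1 : γ ≤ 1 := hγle.trans ((min_le_left _ _).trans (min_le_right _ _))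
  have hγI' : γ ≤ γI := hγle.trans ((min_le_right _ _).trans (min_le_left _ _))
  have hγP' : γ ≤ γP := hγle.trans ((min_le_right _ _).trans (min_le_right _ _))
  obtain ⟨D, hU, hrep, hcau⟩ := hD3 F γ hF hγ hγ₁'
  have hcθ : ∀ i, θBal F.L γ ((max B₃ 1)⁻¹ * b₀) p₀ i ≤ θBal F.L γ b₀ p₀ i :=
    fun i => θBal_mul_le F.hL.2.le hγ hγ1 hb hc1 p₀ i
  have hI' : ∀ i, θBal F.L γ ((max B₃ 1)⁻¹ * b₀) p₀ i ≤ min a₁ (ε₀ / B₃) := by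
    have h := hI γ hγ hγI'
    rw [← hF] at h
    exact h
  have hθa₁ : ∀ i, θBal F.L γ ((max B₃ 1)⁻¹ * b₀) p₀ i ≤ a₁ := fun i => (hI' i).trans (min_le_left _ _)
  have hθε₀ : ∀ i, B₃ * θBal F.L γ ((max B₃ 1)⁻¹ * b₀) p₀ i ≤ ε₀ := fun i => by
    have h := (hI' i).trans (min_le_right _ _)
    rwa [le_div_iff₀ hB₃, mul_comm] at h
  have hm0 : 0 < m := by omega
  -- the interior is print-χ-good for `D.Umin`, both runs (deterministic) — used for BOTH rows
  have hInt : ∀ K, 0 < K → ∀ᵐ V ∂fieldMeasure (F.P (K / m)) 0 (Matrix.specialUnitaryGroup (Fin 2) ℂ),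
      PlaqSmall (θBal F.L γ ((max B₃ 1)⁻¹ * b₀) p₀ (K / m)) V →
        atHeights (printChiSets D b₀ p₀) K (K / m) (Nat.div_le_self K m) V ∧
        atHeights (printChiSets D b₀ p₀) (K + 1) (K / m) ((Nat.div_le_self K m).trans (Nat.le_succ K)) V := by
    intro K hK
    have hlt : K / m < K := Nat.div_lt_self hK (by omega)
    have hlt' : K / m < K + 1 := hlt.trans (Nat.lt_succ_self K)
    exact Filter.Eventually.of_forall fun V hs =>
      ⟨atHeights_printChiSets_of_interior hI8 hF hγ hγ1 hb hc0 hc1 hcB hε₀a hθa₁ hθε₀ hU hlt V hs,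
        atHeights_printChiSets_of_interior hI8 hF hγ hγ1 hb hc0 hc1 hcB hε₀a hθa₁ hθε₀ hU hlt' V hs⟩
  refine fluctuationComparisonRegPrIntAt_of_repOn_cauchyOn_interior hm0 _ _ hrep hcau hcθ hInt hInt (fun K hK => ?_)
  -- positivity on the interior from positivity on the window
  filter_upwards [hP F γ hF hγ hγP' K] with V hpV hs
  exact hpV (fun q => (hs q).trans_le (hcθ _))

end Summit.QuantumFields.YangMills.Theorems.InteriorExcision

end
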